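import Summits.QuantumFields.YangMills.Theorems.BalabanUVNodesN15CurvedGluingLocalGauges
import HarnessLib

/-!
# Route «BalabanUVNodes» (cluster K4 «SpineRates»), Track-A DAG node N15 = NE2, BACKGROUND LAYER — GLUING ACROSS PER-CUBE GAUGES, TWO GRIDS: dag-n15-w3 file 32's η-DEFECT of the glued
# operator (`hasMaj_idef_glued_of_cutRows_defect`) when every cube's parametrix is given in its own gauge on BOTH grids, the fine gauge being the coarse one PULLED BACK along `π`
# (`W′_□ = W_□∘π` — the gauge of a coarse cube read on the fine lattice); the three η-defect row families transfer EXACTLY conjugated (g4 `idef_gaugeConj_of_pullback`) at the cost `|κ|²`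

Cell `pub-ymgap`, seat `pub-ymgap-dag-n15-w2` (WIDTH SEAT 2∕3 on node N15, director-ym №197 ∕ HUMAN RULING D-0149), g5, eighth piece (bus CLAIM-8) — the two-grid half of dag-n15-w3 g4's
located item (o1), sequel of this seat's `…CurvedGluingLocalGauges` (one grid).  `bears_on: R4∕N15 · K3⁸ SpineGivenEndpointR13SepCoPHV (stmt-QuantumFields-27366)`.  Filed
`--kind proof --supports stmt-QuantumFields-27366 --as helper` — COUNT-NEUTRAL.  Theorems only; 0 `def`, 0 `sorry`.  Imports BY NAME `…CurvedGluingLocalGauges` (`localOp_conj_back`,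
`cutRow_of_localGauge`, `commRow_of_localGauge`, `defectRow_of_localGauge`; through it g4 `…DressedGeneralGauge`: `mulOp_comp_gaugeConj`, `commOp_comp_gaugeConj`,
`hasMaj_idef_gaugeConj_of_pullback`, `entry_le_one_of_orthogonal`, `transpose_entry_le_one_of_orthogonal`, and n15-w3 file 32 `hasMaj_idef_glued_of_cutRows_defect`); nothing in the
tree is modified, no landed name re-declared.

WHY.  The η-rate (NE2⁺) compares the glued propagators of two grids `π : X′ → X`.  With per-cube gauges the comparison needs the fine and coarse gauges of the same cube to be related; the
case typed here is the natural one for a coarse-scale cube: the fine gauge IS the coarse gauge pulled back, `W′_k(x′) = W_k(πx′)`, for which the gauge multiplications have NO η-defect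
(g4 `idef_mmulOp_pullback`) and every η-defect row conjugates exactly.  So file 32's two-grid hypotheses for the GLOBAL families `G_k = M_{W_kᵀ}G′_kM_{W_k}` (coarse),
`G⁺_k = M_{(W_k∘π)ᵀ}G″_kM_{W_k∘π}` (fine) follow from the rows ∕ defects of the LOCAL objects with `β, θ₀, ε, m, r, r_E ↦ |κ|²·(β, θ₀, ε, m, r, r_E)`:
* §1 ★ `cutDefect_of_localGauge` (`𝔇(M_{χ′}G⁺_k, M_χG_k)` two-sided `≤ 1_S1_S·|κ|²m·e^{−δd}`), ★★ `commDefect_of_localGauge` (`𝔇([Δ′, M_{h′}]G⁺_k, [Δ, M_h]G_k) ≤ 1_S(y′)·|κ|²r·e^{−δd}` from the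
  LOCAL commutator defect), ★ `defectDefect_of_localGauge`;
* §2 ★★★ `hasMaj_idef_glued_of_localGauges` — file 32's `𝔇(𝒢′, 𝒢)` majorant for the conjugated-back families on two grids, every row ∕ defect given in the cubes' gauges.

HONEST FRAMING ∕ LIMITS.  Bookkeeping over DISPLAYED per-cube rows and defects ((3.34)–(3.35) p. 396, (3.42) p. 397, (3.87) p. 409, Thm 3.14 pp. 426–427 of [B9]; [B6-II] (2.133)–(2.136) =
SHAPES ∕ MECHANISM ∕ TEMPLATE); ONLY the pulled-back fine gauge (two unrelated per-cube gauges with a displayed fit are g4 `hasMaj_idef_gaugeConj` — not here); the gauges, local parametrices,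
rows and defects are HYPOTHESES; cost `|κ|²` crude.  Nothing of [B5]∕[B6]∕[B9] asserted; NE2⁺ NOT PRINTED, NOT proved; N15 NOT discharged; K3⁸ OPEN, skeleton v6 untouched; counts of record
UNMOVED (typed 28∕28 · discharged 5∕27 · A 5∕28); one finite 𝕋⁴ at fixed ε — NOT ℝ⁴ ∕ OS ∕ mass gap ∕ Clay; R4 closes the conditional finite-𝕋⁴ rung `BalabanLadder.UV` only.  Restate-immune.
-/

set_option autoImplicit false

noncomputable section
open scoped BigOperators Matrix
open Finset

namespace Summit.QuantumFields.YangMills.BalabanUVNodes.N15.CurvedSpecies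

open Literature.MathematicalPhysics.QuantumFieldTheory.Balaban1983to89
open Literature.MathematicalPhysics.QuantumFieldTheory.Balaban1983to89.B11SectG (BlockNorm HasMaj RowSum)
open Literature.MathematicalPhysics.QuantumFieldTheory.Balaban1983to89.B6RandomWalk (Triangle254)
open Literature.MathematicalPhysics.QuantumFieldTheory.Balaban1983to89.B6Prop26Gluing (mulOp ind ind_nonneg)
open Literature.MathematicalPhysics.QuantumFieldTheory.Balaban1983to89.T4EtaRateDefect (idef)
open Literature.MathematicalPhysics.QuantumFieldTheory.Balaban1983to89.T4EtaRateCoeffDefect (pull)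
open Summit.QuantumFields.YangMills.BalabanUVNodes.N15.MatrixSpecies (mmulOp liftBlk liftMap)
open Summit.QuantumFields.YangMills.BalabanUVNodes.N15.Gluing (parametrix remainder commOp glueInv)

variable {X X' : Type} [Fintype X] [Fintype X'] [DecidableEq X] [DecidableEq X'] {κ : Type} [Fintype κ] [DecidableEq κ] {K : Type} [Fintype K] {g : B6.Geometry}
  (blk : X → g.Site) (π : X' → X) (S : K → Set g.Site) (W : K → X → Matrix κ κ ℝ)
  (Δ : (X × κ → ℝ) →ₗ[ℝ] (X × κ → ℝ)) (Δ' : (X' × κ → ℝ) →ₗ[ℝ] (X' × κ → ℝ)) (hX χX : K → X → ℝ) (hX' χX' : K → X' → ℝ)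
  (G' E' : K → (X × κ → ℝ) →ₗ[ℝ] (X × κ → ℝ)) (G'' E'' : K → (X' × κ → ℝ) →ₗ[ℝ] (X' × κ → ℝ))

/-! ## §1 The three η-defect row families transfer in the pulled-back gauge -/

section Rows

omit [DecidableEq X] [DecidableEq X'] [Fintype K] in
/-- ★ **CUT DEFECTS TRANSFER**: `𝔇(M_{χ′}G″, M_χG′) ≤ 1_S1_S·me^{−δd}` for the LOCAL objects (fine gauge `W∘π`) ⟹ the same for the conjugated-back pair with `|κ|²m`.
[cite: Balaban1985BackgroundPropagators, (3.34)–(3.35) p.396, (3.42) p.397, Thm 3.14 pp.426–427 (shapes)] -/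
theorem cutDefect_of_localGauge (hW : ∀ k x, W k x * (W k x)ᵀ = 1) (hW' : ∀ k x, (W k x)ᵀ * W k x = 1) {m δ : ℝ} (hm : 0 ≤ m) (k : K)
    (hD : HasMaj (BlockNorm.ofBlocks g (liftBlk blk κ)) (BlockNorm.ofBlocks g (liftBlk (blk ∘ π) κ))
      (idef (pull (liftMap π κ)) (pull (liftMap π κ)) (mulOp (fun p : X' × κ => χX' k p.1) ∘ₗ G'' k) (mulOp (fun p : X × κ => χX k p.1) ∘ₗ G' k))
      (fun y y' => ind (S k) y * ind (S k) y' * (m * Real.exp (-(δ * g.dist y y'))))) :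
    HasMaj (BlockNorm.ofBlocks g (liftBlk blk κ)) (BlockNorm.ofBlocks g (liftBlk (blk ∘ π) κ))
      (idef (pull (liftMap π κ)) (pull (liftMap π κ))
        (mulOp (fun p : X' × κ => χX' k p.1) ∘ₗ (mmulOp (fun x' => (W k (π x'))ᵀ) ∘ₗ G'' k ∘ₗ mmulOp (fun x' => W k (π x'))))
        (mulOp (fun p : X × κ => χX k p.1) ∘ₗ (mmulOp (fun x => (W k x)ᵀ) ∘ₗ G' k ∘ₗ mmulOp (W k))))
      (fun y y' => ind (S k) y * ind (S k) y' * ((Fintype.card κ : ℝ) ^ 2 * m * Real.exp (-(δ * g.dist y y')))) := by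
  have e := mulOp_comp_gaugeConj (fun x => (W k x)ᵀ) (χX k) (G' k)
  have e' := mulOp_comp_gaugeConj (fun x' => (W k (π x'))ᵀ) (χX' k) (G'' k)
  simp only [Matrix.transpose_transpose] at e e'
  rw [show (fun x => W k x) = W k from rfl] at e
  rw [e, e']
  have h := hasMaj_idef_gaugeConj_of_pullback π (fun x => (W k x)ᵀ) blk (fun y y' => ?_) (transpose_entry_le_one_of_orthogonal (hW' k))
    (fun x i j => by rw [Matrix.transpose_transpose]; exact entry_le_one_of_orthogonal (hW k) x i j) hD
  · simp only [Matrix.transpose_transpose] at h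
    rw [show (fun x => W k x) = W k from rfl] at h
    exact h.mono fun y y' => le_of_eq (by ring)
  · exact mul_nonneg (mul_nonneg (ind_nonneg _ y) (ind_nonneg _ y')) (mul_nonneg hm (Real.exp_nonneg _))

omit [DecidableEq X] [DecidableEq X'] [Fintype K] in
/-- ★★ **COMMUTATOR DEFECTS TRANSFER**: the LOCAL commutator defect `𝔇([Δ′^{W∘π}, M_{h′}]G″, [Δ^W, M_h]G′) ≤ 1_S(y′)·re^{−δd}` (`Δ^W = M_WΔM_{Wᵀ}`, `Δ′^{W∘π} = M_{W∘π}Δ′M_{(W∘π)ᵀ}`) ⟹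
`𝔇([Δ′, M_{h′}]G⁺, [Δ, M_h]G) ≤ 1_S(y′)·|κ|²r·e^{−δd}` for the conjugated-back pair. [cite: Balaban1984PropagatorsII, (2.93) p.239 (shape); Balaban1985BackgroundPropagators, (3.34) p.396, Thm 3.14 pp.426–427] -/
theorem commDefect_of_localGauge (hW : ∀ k x, W k x * (W k x)ᵀ = 1) (hW' : ∀ k x, (W k x)ᵀ * W k x = 1) {r δ : ℝ} (hr : 0 ≤ r) (k : K)
    (hD : HasMaj (BlockNorm.ofBlocks g (liftBlk blk κ)) (BlockNorm.ofBlocks g (liftBlk (blk ∘ π) κ))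
      (idef (pull (liftMap π κ)) (pull (liftMap π κ))
        (commOp (mmulOp (fun x' => W k (π x')) ∘ₗ Δ' ∘ₗ mmulOp (fun x' => (W k (π x'))ᵀ)) (fun p : X' × κ => hX' k p.1) ∘ₗ G'' k)
        (commOp (mmulOp (W k) ∘ₗ Δ ∘ₗ mmulOp (fun x => (W k x)ᵀ)) (fun p : X × κ => hX k p.1) ∘ₗ G' k))
      (fun y y' => ind (S k) y' * (r * Real.exp (-(δ * g.dist y y'))))) :
    HasMaj (BlockNorm.ofBlocks g (liftBlk blk κ)) (BlockNorm.ofBlocks g (liftBlk (blk ∘ π) κ))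
      (idef (pull (liftMap π κ)) (pull (liftMap π κ))
        (commOp Δ' (fun p : X' × κ => hX' k p.1) ∘ₗ (mmulOp (fun x' => (W k (π x'))ᵀ) ∘ₗ G'' k ∘ₗ mmulOp (fun x' => W k (π x'))))
        (commOp Δ (fun p : X × κ => hX k p.1) ∘ₗ (mmulOp (fun x => (W k x)ᵀ) ∘ₗ G' k ∘ₗ mmulOp (W k))))
      (fun y y' => ind (S k) y' * ((Fintype.card κ : ℝ) ^ 2 * r * Real.exp (-(δ * g.dist y y')))) := by
  have hV' : ∀ x, ((W k x)ᵀ)ᵀ * (W k x)ᵀ = 1 := fun x => by rw [Matrix.transpose_transpose]; exact hW k x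
  have hVπ' : ∀ x', ((W k (π x'))ᵀ)ᵀ * (W k (π x'))ᵀ = 1 := fun x' => hV' (π x')
  have e := commOp_comp_gaugeConj (fun x => (W k x)ᵀ) hV' (hX k) (mmulOp (W k) ∘ₗ Δ ∘ₗ mmulOp (fun x => (W k x)ᵀ)) (G' k)
  have e' := commOp_comp_gaugeConj (fun x' => (W k (π x'))ᵀ) hVπ' (hX' k) (mmulOp (fun x' => W k (π x')) ∘ₗ Δ' ∘ₗ mmulOp (fun x' => (W k (π x'))ᵀ)) (G'' k)
  simp only [Matrix.transpose_transpose] at e e'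
  rw [show (fun x => W k x) = W k from rfl, localOp_conj_back W Δ hW' k] at e
  rw [transpose_gaugeConj_cancel (fun x' => W k (π x')) (fun x' => hW' k (π x')) Δ'] at e'
  rw [e, e']
  have h := hasMaj_idef_gaugeConj_of_pullback π (fun x => (W k x)ᵀ) blk (fun y y' => ?_) (transpose_entry_le_one_of_orthogonal (hW' k))
    (fun x i j => by rw [Matrix.transpose_transpose]; exact entry_le_one_of_orthogonal (hW k) x i j) hD
  · simp only [Matrix.transpose_transpose] at h
    rw [show (fun x => W k x) = W k from rfl] at h
    exact h.mono fun y y' => le_of_eq (by ring)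
  · exact mul_nonneg (ind_nonneg _ y') (mul_nonneg hr (Real.exp_nonneg _))

omit [DecidableEq X] [DecidableEq X'] [Fintype K] in
/-- ★ **DEFECT-ROW DEFECTS TRANSFER**: `𝔇(E″, E′) ≤ 1_S(y)·r_Ee^{−δd}` ⟹ `𝔇(M_{(W∘π)ᵀ}E″M_{W∘π}, M_{Wᵀ}E′M_W) ≤ 1_S(y)·|κ|²r_E·e^{−δd}`. [cite: Balaban1985BackgroundPropagators, (3.34)–(3.35) p.396, Thm 3.14 pp.426–427 (shapes)] -/
theorem defectDefect_of_localGauge (hW : ∀ k x, W k x * (W k x)ᵀ = 1) (hW' : ∀ k x, (W k x)ᵀ * W k x = 1) {rE δ : ℝ} (hrE : 0 ≤ rE) (k : K)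
    (hD : HasMaj (BlockNorm.ofBlocks g (liftBlk blk κ)) (BlockNorm.ofBlocks g (liftBlk (blk ∘ π) κ)) (idef (pull (liftMap π κ)) (pull (liftMap π κ)) (E'' k) (E' k))
      (fun y y' => ind (S k) y * (rE * Real.exp (-(δ * g.dist y y'))))) :
    HasMaj (BlockNorm.ofBlocks g (liftBlk blk κ)) (BlockNorm.ofBlocks g (liftBlk (blk ∘ π) κ))
      (idef (pull (liftMap π κ)) (pull (liftMap π κ)) (mmulOp (fun x' => (W k (π x'))ᵀ) ∘ₗ E'' k ∘ₗ mmulOp (fun x' => W k (π x')))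
        (mmulOp (fun x => (W k x)ᵀ) ∘ₗ E' k ∘ₗ mmulOp (W k)))
      (fun y y' => ind (S k) y * ((Fintype.card κ : ℝ) ^ 2 * rE * Real.exp (-(δ * g.dist y y')))) := by
  have h := hasMaj_idef_gaugeConj_of_pullback π (fun x => (W k x)ᵀ) blk (fun y y' => ?_) (transpose_entry_le_one_of_orthogonal (hW' k))
    (fun x i j => by rw [Matrix.transpose_transpose]; exact entry_le_one_of_orthogonal (hW k) x i j) hD
  · simp only [Matrix.transpose_transpose] at h
    rw [show (fun x => W k x) = W k from rfl] at h
    exact h.mono fun y y' => le_of_eq (by ring)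
  · exact mul_nonneg (ind_nonneg _ y) (mul_nonneg hrE (Real.exp_nonneg _))

end Rows

/-! ## §2 File 32's two-grid gluing with the cubes given in their own (pulled-back) gauges -/

section Glue

variable {σ cr : ℝ}

/-- ★★★ **THE η-DEFECT OF THE GLUED OPERATOR BUILT FROM PER-CUBE-GAUGE PARAMETRICES** — file 32 `hasMaj_idef_glued_of_cutRows_defect` for the conjugated-back families on two grids
(`G_k = M_{W_kᵀ}G′_kM_{W_k}`, `G⁺_k = M_{(W_k∘π)ᵀ}G″_kM_{W_k∘π}`, likewise `E_k, E⁺_k`), ALL rows ∕ defects given in the cubes' gauges (cut rows `β`, commutator rows `θ₀` w.r.t. the LOCAL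
operators `Δ^{W_k}`, `Δ′^{W_k∘π}`, defect rows `ε`; cut ∕ commutator ∕ defect-row η-DEFECTS `m, r, r_E`), partition letters `|h| ≤ 1`, fit `o`, overlap `N_ov`, `2σ ≤ δ`,
`N_ov|κ|²(θ₀ + ε)c_r < 1` ⟹ file 32's conclusion with `(β, θ₀, ε, m, r, r_E) ↦ |κ|²·(β, θ₀, ε, m, r, r_E)`.
[cite: Balaban1985BackgroundPropagators, (3.34)–(3.35) p.396, (3.87) p.409, Thm 3.14 pp.426–427 (shapes ∕ template); Balaban1984PropagatorsII, (2.91) p.239, (2.133)–(2.136) p.247] -/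
theorem hasMaj_idef_glued_of_localGauges (htri : Triangle254 g) (hd : ∀ a b : g.Site, 0 ≤ g.dist a b) (hd0 : ∀ y : g.Site, g.dist y y = 0) (hrow : RowSum g σ cr) (hσ : 0 ≤ σ)
    (hcr : 0 ≤ cr) (hW : ∀ k x, W k x * (W k x)ᵀ = 1) (hW' : ∀ k x, (W k x)ᵀ * W k x = 1) {β θ₀ ε m r rE o δ Nov : ℝ} (hβ : 0 ≤ β) (hθ : 0 ≤ θ₀) (hε : 0 ≤ ε) (hm : 0 ≤ m)
    (hr : 0 ≤ r) (hrE : 0 ≤ rE) (ho : 0 ≤ o) (hNov : 0 ≤ Nov) (hσδ : 2 * σ ≤ δ)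
    (hcut : ∀ k, mulOp (fun p : X × κ => hX k p.1) ∘ₗ mulOp (fun p : X × κ => χX k p.1) = mulOp (fun p : X × κ => hX k p.1))
    (hcut' : ∀ k, mulOp (fun p : X' × κ => hX' k p.1) ∘ₗ mulOp (fun p : X' × κ => χX' k p.1) = mulOp (fun p : X' × κ => hX' k p.1))
    (hh : ∀ k p, |(fun p : X × κ => hX k p.1) p| ≤ 1) (hh' : ∀ k p, |(fun p : X' × κ => hX' k p.1) p| ≤ 1)
    (hfit : ∀ k p, |(fun p : X' × κ => hX' k p.1) p - (fun p : X × κ => hX k p.1) (liftMap π κ p)| ≤ o) (hN : ∀ a, ∑ k, ind (S k) a ≤ Nov)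
    -- rows in the cubes' gauges, both grids
    (hGc : ∀ k, HasMaj (BlockNorm.ofBlocks g (liftBlk blk κ)) (BlockNorm.ofBlocks g (liftBlk blk κ)) (mulOp (fun p : X × κ => χX k p.1) ∘ₗ G' k)
      (fun y y' => ind (S k) y * ind (S k) y' * (β * Real.exp (-(δ * g.dist y y')))))
    (hGc' : ∀ k, HasMaj (BlockNorm.ofBlocks g (liftBlk (blk ∘ π) κ)) (BlockNorm.ofBlocks g (liftBlk (blk ∘ π) κ)) (mulOp (fun p : X' × κ => χX' k p.1) ∘ₗ G'' k)
      (fun y y' => ind (S k) y * ind (S k) y' * (β * Real.exp (-(δ * g.dist y y')))))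
    (hK : ∀ k, HasMaj (BlockNorm.ofBlocks g (liftBlk blk κ)) (BlockNorm.ofBlocks g (liftBlk blk κ))
      (commOp (mmulOp (W k) ∘ₗ Δ ∘ₗ mmulOp (fun x => (W k x)ᵀ)) (fun p : X × κ => hX k p.1) ∘ₗ G' k) (fun y y' => ind (S k) y' * (θ₀ * Real.exp (-(δ * g.dist y y')))))
    (hK' : ∀ k, HasMaj (BlockNorm.ofBlocks g (liftBlk (blk ∘ π) κ)) (BlockNorm.ofBlocks g (liftBlk (blk ∘ π) κ))
      (commOp (mmulOp (fun x' => W k (π x')) ∘ₗ Δ' ∘ₗ mmulOp (fun x' => (W k (π x'))ᵀ)) (fun p : X' × κ => hX' k p.1) ∘ₗ G'' k)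
      (fun y y' => ind (S k) y' * (θ₀ * Real.exp (-(δ * g.dist y y')))))
    (hE : ∀ k, HasMaj (BlockNorm.ofBlocks g (liftBlk blk κ)) (BlockNorm.ofBlocks g (liftBlk blk κ)) (E' k) (fun y y' => ind (S k) y * (ε * Real.exp (-(δ * g.dist y y')))))
    (hE' : ∀ k, HasMaj (BlockNorm.ofBlocks g (liftBlk (blk ∘ π) κ)) (BlockNorm.ofBlocks g (liftBlk (blk ∘ π) κ)) (E'' k) (fun y y' => ind (S k) y * (ε * Real.exp (-(δ * g.dist y y')))))
    -- η-defects in the cubes' gauges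
    (hDGc : ∀ k, HasMaj (BlockNorm.ofBlocks g (liftBlk blk κ)) (BlockNorm.ofBlocks g (liftBlk (blk ∘ π) κ))
      (idef (pull (liftMap π κ)) (pull (liftMap π κ)) (mulOp (fun p : X' × κ => χX' k p.1) ∘ₗ G'' k) (mulOp (fun p : X × κ => χX k p.1) ∘ₗ G' k))
      (fun y y' => ind (S k) y * ind (S k) y' * (m * Real.exp (-(δ * g.dist y y')))))
    (hDK : ∀ k, HasMaj (BlockNorm.ofBlocks g (liftBlk blk κ)) (BlockNorm.ofBlocks g (liftBlk (blk ∘ π) κ))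
      (idef (pull (liftMap π κ)) (pull (liftMap π κ))
        (commOp (mmulOp (fun x' => W k (π x')) ∘ₗ Δ' ∘ₗ mmulOp (fun x' => (W k (π x'))ᵀ)) (fun p : X' × κ => hX' k p.1) ∘ₗ G'' k)
        (commOp (mmulOp (W k) ∘ₗ Δ ∘ₗ mmulOp (fun x => (W k x)ᵀ)) (fun p : X × κ => hX k p.1) ∘ₗ G' k))
      (fun y y' => ind (S k) y' * (r * Real.exp (-(δ * g.dist y y')))))
    (hDE : ∀ k, HasMaj (BlockNorm.ofBlocks g (liftBlk blk κ)) (BlockNorm.ofBlocks g (liftBlk (blk ∘ π) κ)) (idef (pull (liftMap π κ)) (pull (liftMap π κ)) (E'' k) (E' k))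
      (fun y y' => ind (S k) y * (rE * Real.exp (-(δ * g.dist y y')))))
    (hq : Nov * ((Fintype.card κ : ℝ) ^ 2 * θ₀ + (Fintype.card κ : ℝ) ^ 2 * ε) * cr < 1) :
    HasMaj (BlockNorm.ofBlocks g (liftBlk blk κ)) (BlockNorm.ofBlocks g (liftBlk (blk ∘ π) κ))
      (idef (pull (liftMap π κ)) (pull (liftMap π κ))
        (glueInv (parametrix (fun k => fun p : X' × κ => hX' k p.1) (fun k => mmulOp (fun x' => (W k (π x'))ᵀ) ∘ₗ G'' k ∘ₗ mmulOp (fun x' => W k (π x'))))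
          (remainder Δ' (fun k => fun p : X' × κ => hX' k p.1) (fun k => mmulOp (fun x' => (W k (π x'))ᵀ) ∘ₗ G'' k ∘ₗ mmulOp (fun x' => W k (π x'))) -
            ∑ k, (mmulOp (fun x' => (W k (π x'))ᵀ) ∘ₗ E'' k ∘ₗ mmulOp (fun x' => W k (π x'))) ∘ₗ mulOp (fun p : X' × κ => hX' k p.1)))
        (glueInv (parametrix (fun k => fun p : X × κ => hX k p.1) (fun k => mmulOp (fun x => (W k x)ᵀ) ∘ₗ G' k ∘ₗ mmulOp (W k)))
          (remainder Δ (fun k => fun p : X × κ => hX k p.1) (fun k => mmulOp (fun x => (W k x)ᵀ) ∘ₗ G' k ∘ₗ mmulOp (W k)) -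
            ∑ k, (mmulOp (fun x => (W k x)ᵀ) ∘ₗ E' k ∘ₗ mmulOp (W k)) ∘ₗ mulOp (fun p : X × κ => hX k p.1))))
      (fun y y' => (Nov * ((Fintype.card κ : ℝ) ^ 2 * β) * ((1 - Nov * ((Fintype.card κ : ℝ) ^ 2 * θ₀ + (Fintype.card κ : ℝ) ^ 2 * ε) * cr)⁻¹ *
          ((1 - Nov * ((Fintype.card κ : ℝ) ^ 2 * θ₀ + (Fintype.card κ : ℝ) ^ 2 * ε) * cr)⁻¹ *
            (Nov * ((Fintype.card κ : ℝ) ^ 2 * θ₀ * o + (Fintype.card κ : ℝ) ^ 2 * r + ((Fintype.card κ : ℝ) ^ 2 * ε * o + (Fintype.card κ : ℝ) ^ 2 * rE))) * cr) * cr) * cr +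
        Nov * (2 * ((Fintype.card κ : ℝ) ^ 2 * β) * o + (Fintype.card κ : ℝ) ^ 2 * m) * (1 - Nov * ((Fintype.card κ : ℝ) ^ 2 * θ₀ + (Fintype.card κ : ℝ) ^ 2 * ε) * cr)⁻¹ * cr) *
        Real.exp (-((δ - 2 * σ) * g.dist y y'))) := by
  have hWπ : ∀ k x', W k (π x') * (W k (π x'))ᵀ = 1 := fun k x' => hW k (π x')
  have hWπ' : ∀ k x', (W k (π x'))ᵀ * W k (π x') = 1 := fun k x' => hW' k (π x')
  exact hasMaj_idef_glued_of_cutRows_defect (liftBlk blk κ) (liftMap π κ) S htri hd hd0 hrow hσ hcr (by positivity) (by positivity) (by positivity) (by positivity) (by positivity)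
    (by positivity) ho hNov hσδ hcut hcut' hh hh' hfit hN
    (fun k => cutRow_of_localGauge blk S W χX G' hW hW' hβ k (hGc k))
    (fun k => cutRow_of_localGauge (blk ∘ π) S (fun k x' => W k (π x')) χX' G'' hWπ hWπ' hβ k (hGc' k))
    (fun k => commRow_of_localGauge blk S W Δ hX G' hW hW' hθ k (hK k))
    (fun k => commRow_of_localGauge (blk ∘ π) S (fun k x' => W k (π x')) Δ' hX' G'' hWπ hWπ' hθ k (hK' k))
    (fun k => defectRow_of_localGauge blk S W E' hW hW' hε k (hE k))
    (fun k => defectRow_of_localGauge (blk ∘ π) S (fun k x' => W k (π x')) E'' hWπ hWπ' hε k (hE' k))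
    (fun k => cutDefect_of_localGauge blk π S W χX χX' G' G'' hW hW' hm k (hDGc k))
    (fun k => commDefect_of_localGauge blk π S W Δ Δ' hX hX' G' G'' hW hW' hr k (hDK k))
    (fun k => defectDefect_of_localGauge blk π S W E' E'' hW hW' hrE k (hDE k)) hq

end Glue

end Summit.QuantumFields.YangMills.BalabanUVNodes.N15.CurvedSpecies

end
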